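import Literature.Computability.AlgebraicComplexity.MS2001KempfStabilityHolds
import Mathlib.LinearAlgebra.Matrix.Permutation
import Mathlib.FieldTheory.Separable
import HarnessLib

/-!
# The power sum `x₁^D + ⋯ + x_m^D` has a closed `SL_m`-orbit over every algebraically closed field
# with `char ∤ D` (`m ≥ 3`, `D ≥ 3`) — Bürgisser–Ikenmeyer 2017 Cor. 2.9, power-sum clause, in all
# characteristics, by Kempf's criterion

Bürgisser–Ikenmeyer 2017, Cor. 2.9: "the forms `X₁⋯X_m`, `X₁^D + ⋯ + X_m^D` if `D > 1`, `det_n`,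
and `per_n` are all polystable" (over `ℂ`; tree: `BurgisserIkenmeyer2017_polystable_det_per_holds`,
`isPolystable_prod_X`, `isPolystable_sum_X_pow`, all via Kempf–Ness). With Kempf's criterion for
`SL_σ` on forms over ANY algebraically closed field now in the tree
(`MS2001KempfStabilityHolds.isPolystable_of_forall_submodule_sl`), the clauses `det_n`, `per_n`
(`MS2001_thm_4_6_holds`, `MS2001_thm_4_7_holds`) and `X₁⋯X_m` (`MS2001FormERowOne.
isPolystable_prod_X_of_isAlgClosed`) hold in every characteristic. THIS FILE adds the POWER-SUM
clause where the irreducibility route applies: for `|ι| ≥ 3`, `D ≥ 3` and `(D : K) ≠ 0`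
(`char K ∤ D`) the `SL`-stabiliser of `∑ xᵢ^D` — containing `diag(ζ, ζ⁻¹, 1, …)` for `ζ^D = 1` and
the even permutation matrices — acts irreducibly on `K^ι` (a `D`-th root of unity with `ζ² ≠ 1`
exists since `X^D − 1` has `D ≥ 3` distinct roots; it cuts a stable subspace down to an elementary
vector; double transpositions move it everywhere), so the orbit is closed
(`isPolystable_sum_X_pow_of_isAlgClosed`). Scope caveats, stated honestly: the hypotheses `|ι| ≥ 3`,
`D ≥ 3`, `char ∤ D` are those of THIS proof; BI17 state `D > 1`, any `m`, over `ℂ` (for `D = 2` or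
`m = 2` the stabiliser route needs `SO`/binary-form arguments not done here); in characteristic
`p ∣ D` the statement is false in general (`x^p + y^p = (x+y)^p` is unstable).

THEOREMS ONLY (no definitions, no named facts). Cell `val-lit`, seat t14 g7 (programme #9
follow-up). Nothing here bears on `VP` versus `VNP`.

## References

* [BurgisserIkenmeyer2017] P. Bürgisser, C. Ikenmeyer, *Fundamental invariants of orbit closures*,
  J. Algebra 477 (2017), Def. 2.7, Cor. 2.9.
* [Kempf1978] G. R. Kempf, *Instability in invariant theory*, Ann. of Math. 108 (1978), Cor. 4.5.
-/

noncomputable section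

open scoped BigOperators
open MvPolynomial

namespace Literature.Computability.AlgebraicComplexity

variable {K : Type} [Field K] {ι : Type} [Fintype ι] [DecidableEq ι]

omit [DecidableEq ι] in
/-- `∑ xᵢ^D` is a form of degree `D`. [cite: BurgisserIkenmeyer2017, Cor. 2.9 (the form `X₁^D + ⋯ + X_m^D`)] -/
theorem isHomogeneous_sum_X_pow_univ (D : ℕ) :
    (∑ i : ι, X i ^ D : MvPolynomial ι K).IsHomogeneous D := by
  refine IsHomogeneous.sum Finset.univ (fun i : ι => (X i : MvPolynomial ι K) ^ D) D fun i _ => ?_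
  simpa using (isHomogeneous_X K i).pow D

/-- A diagonal matrix of `D`-th roots of unity fixes `∑ xᵢ^D`. [cite: BurgisserIkenmeyer2017, Cor. 2.9 (the form `X₁^D + ⋯ + X_m^D`)] -/
theorem linSubst_diagonal_sum_X_pow {D : ℕ} (β : ι → K) (hβ : ∀ i, β i ^ D = 1) :
    linSubst ι K (Matrix.diagonal β) (∑ i : ι, X i ^ D) = ∑ i : ι, X i ^ D := by
  rw [map_sum]
  refine Finset.sum_congr rfl fun i _ => ?_
  have hX : linSubst ι K (Matrix.diagonal β) (X i) = C (β i) * X i := by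
    rw [linSubst_X, Finset.sum_eq_single i (fun j _ hj => by
      rw [Matrix.diagonal_apply_ne _ hj, zero_smul]) (fun h => absurd (Finset.mem_univ i) h),
      Matrix.diagonal_apply_eq, smul_eq_C_mul]
  rw [map_pow, hX, mul_pow, ← C_pow, hβ i, C_1, one_mul]

omit [Fintype ι] in
/-- Entries of a permutation matrix. [folklore] -/
private theorem permMatrix_apply'' (π : Equiv.Perm ι) (j i : ι) :
    (π.permMatrix K) j i = if i = π j then (1 : K) else 0 := by
  rw [Equiv.Perm.permMatrix, PEquiv.toMatrix_toPEquiv_apply, Pi.single_apply]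

/-- A permutation matrix sends `xᵢ` to `x_{π⁻¹ i}`. [folklore] -/
private theorem linSubst_permMatrix_X' (π : Equiv.Perm ι) (i : ι) :
    linSubst ι K (π.permMatrix K) (X i) = X (π.symm i) := by
  rw [linSubst_X, Finset.sum_eq_single (π.symm i)]
  · rw [permMatrix_apply'', if_pos (Equiv.apply_symm_apply π i).symm, one_smul]
  · intro j _ hj
    rw [permMatrix_apply'', if_neg, zero_smul]
    intro h
    apply hj
    rw [h, Equiv.symm_apply_apply]
  · intro h
    exact absurd (Finset.mem_univ _) h

/-- Permutation matrices fix `∑ xᵢ^D`. [cite: BurgisserIkenmeyer2017, Cor. 2.9 (the form `X₁^D + ⋯ + X_m^D`)] -/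
theorem linSubst_permMatrix_sum_X_pow (π : Equiv.Perm ι) (D : ℕ) :
    linSubst ι K (π.permMatrix K) (∑ i : ι, X i ^ D) = ∑ i : ι, X i ^ D := by
  rw [map_sum]
  simp_rw [map_pow, linSubst_permMatrix_X']
  exact Equiv.sum_comp π.symm (fun i => (X i : MvPolynomial ι K) ^ D)

/-- A permutation matrix moves elementary vectors: `P_π e_{i} = e_{π⁻¹ i}`. [folklore] -/
private theorem permMatrix_mulVec_single' (π : Equiv.Perm ι) (i : ι) :
    (π.permMatrix K).mulVec (Pi.single i 1) = Pi.single (π.symm i) 1 := by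
  funext j
  rw [Matrix.mulVec, dotProduct, Finset.sum_eq_single i]
  · rw [Pi.single_eq_same, mul_one, permMatrix_apply'', Pi.single_apply]
    by_cases h : j = π.symm i
    · rw [if_pos h, if_pos]; rw [h, Equiv.apply_symm_apply]
    · rw [if_neg h, if_neg]; intro h'; apply h; rw [h', Equiv.symm_apply_apply]
  · intro l _ hl
    rw [Pi.single_apply, if_neg hl, mul_zero]
  · intro h
    exact absurd (Finset.mem_univ _) h

omit [Fintype ι] [DecidableEq ι] in
/-- **A `D`-th root of unity with `ζ² ≠ 1`** exists in an algebraically closed field with `char ∤ D`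
when `D ≥ 3`: `X^D − 1` is separable, so it has `D` distinct roots, not all in `{1, −1}`. [folklore] -/
private theorem exists_pow_eq_one_ne_one_ne_neg_one [IsAlgClosed K] {D : ℕ} (hD : 3 ≤ D) (hDK : (D : K) ≠ 0) :
    ∃ ζ : K, ζ ^ D = 1 ∧ ζ ≠ 1 ∧ ζ ≠ -1 := by
  classical
  set p : Polynomial K := Polynomial.X ^ D - Polynomial.C 1 with hp
  have hsep : p.Separable := Polynomial.separable_X_pow_sub_C 1 hDK one_ne_zero
  have hcard : p.roots.toFinset.card = D := by
    rw [Multiset.toFinset_card_of_nodup (Polynomial.nodup_roots hsep),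
      IsAlgClosed.card_roots_eq_natDegree, hp, Polynomial.natDegree_X_pow_sub_C]
  have hlt : ({1, -1} : Finset K).card < p.roots.toFinset.card := by
    rw [hcard]
    exact lt_of_le_of_lt (Finset.card_insert_le _ _) (by rw [Finset.card_singleton]; omega)
  obtain ⟨ζ, hζ, hζn⟩ := Finset.exists_mem_notMem_of_card_lt_card hlt
  simp only [Finset.mem_insert, Finset.mem_singleton, not_or] at hζn
  rw [Multiset.mem_toFinset, Polynomial.mem_roots hsep.ne_zero, Polynomial.IsRoot.def, hp,
    Polynomial.eval_sub, Polynomial.eval_pow, Polynomial.eval_X, Polynomial.eval_C, sub_eq_zero] at hζ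
  exact ⟨ζ, hζ, hζn.1, hζn.2⟩

/-- **The `SL`-stabiliser of `∑ xᵢ^D` acts irreducibly on `K^ι`** for `|ι| ≥ 3`, `D ≥ 3`,
`char K ∤ D`, `K` algebraically closed: the torus element `diag(ζ, ζ⁻¹, 1, …)` (`ζ^D = 1`,
`ζ² ≠ 1`) cuts a non-zero vector of a stable subspace down to an elementary vector, and the even
permutation matrices move it to every elementary vector. [cite: Kempf1978, Cor. 4.5] [cite: BurgisserIkenmeyer2017, Cor. 2.9 (the form `X₁^D + ⋯ + X_m^D`)] -/
theorem forall_submodule_stable_sum_X_pow [IsAlgClosed K] {D : ℕ} (hD : 3 ≤ D) (hDK : (D : K) ≠ 0)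
    (hι : 3 ≤ Fintype.card ι) (W : Submodule K (ι → K))
    (hW : ∀ γ : Matrix.SpecialLinearGroup ι K,
      linSubst ι K (γ : Matrix ι ι K) (∑ i : ι, X i ^ D) = ∑ i : ι, X i ^ D →
        ∀ x ∈ W, (γ : Matrix ι ι K).mulVec x ∈ W) :
    W = ⊥ ∨ W = ⊤ := by
  classical
  rcases eq_or_ne W ⊥ with h | h
  · exact Or.inl h
  right
  obtain ⟨w, hw, hw0⟩ := (Submodule.ne_bot_iff W).mp h
  obtain ⟨i₀, hi₀⟩ := Function.ne_iff.mp hw0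
  rw [Pi.zero_apply] at hi₀
  obtain ⟨i₁, hi₁⟩ := Fintype.exists_ne_of_one_lt_card (by omega) i₀
  -- a root of unity `ζ` with `ζ ≠ 0`, `ζ ≠ 1`, `ζ² ≠ 1`
  obtain ⟨θ, hθD, hθ1, hθm1⟩ := exists_pow_eq_one_ne_one_ne_neg_one (K := K) hD hDK
  have hθ0 : θ ≠ 0 := by
    intro h0
    rw [h0, zero_pow (by omega)] at hθD
    exact zero_ne_one hθD
  have hθsq : θ - θ⁻¹ ≠ 0 := by
    intro h0
    have h1 : θ * θ = 1 := by
      have := sub_eq_zero.mp h0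
      field_simp at this
      linear_combination this
    rcases mul_self_eq_one_iff.mp h1 with h2 | h2
    · exact hθ1 h2
    · exact hθm1 h2
  -- the torus element `T = diag(β)`, `β = (θ at i₀, θ⁻¹ at i₁, 1 elsewhere)`
  set β : ι → K := fun i => (if i = i₀ then θ else 1) * (if i = i₁ then θ⁻¹ else 1) with hβ
  have hβprod : ∏ i, β i = 1 := by
    rw [hβ, Finset.prod_mul_distrib, Finset.prod_ite_eq', Finset.prod_ite_eq', if_pos (Finset.mem_univ _),
      if_pos (Finset.mem_univ _), mul_inv_cancel₀ hθ0]
  have hβ₀ : β i₀ = θ := by simp [hβ, hi₁.symm]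
  have hβ₁ : β i₁ = θ⁻¹ := by simp [hβ, hi₁]
  have hβe : ∀ i, i ≠ i₀ → i ≠ i₁ → β i = 1 := fun i h0 h1 => by simp [hβ, h0, h1]
  have hβD : ∀ i, β i ^ D = 1 := by
    intro i
    by_cases h0 : i = i₀
    · rw [h0, hβ₀, hθD]
    · by_cases h1 : i = i₁
      · rw [h1, hβ₁, inv_pow, hθD, inv_one]
      · rw [hβe i h0 h1, one_pow]
  let T : Matrix.SpecialLinearGroup ι K :=
    ⟨Matrix.diagonal β, by rw [Matrix.det_diagonal, hβprod]⟩
  have hTfix : linSubst ι K (T : Matrix ι ι K) (∑ i : ι, X i ^ D) = ∑ i : ι, X i ^ D :=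
    linSubst_diagonal_sum_X_pow β hβD
  have hTmul : ∀ x : ι → K, (T : Matrix ι ι K).mulVec x = fun i => β i * x i := fun x => by
    funext i
    exact Matrix.mulVec_diagonal β x i
  -- cut `w` down to `e_{i₀}`
  have hy : (fun i => β i * w i) - w ∈ W := by
    have := hW T hTfix w hw
    rw [hTmul] at this
    exact W.sub_mem this hw
  have hz : (fun i => β i * (β i * w i - w i)) - θ⁻¹ • ((fun i => β i * w i) - w) ∈ W := by
    have := hW T hTfix _ hy
    rw [hTmul] at this
    exact W.sub_mem this (W.smul_mem _ hy)
  have hzeq : (fun i => β i * (β i * w i - w i)) - θ⁻¹ • ((fun i => β i * w i) - w) =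
      ((θ - θ⁻¹) * (θ - 1) * w i₀) • (Pi.single i₀ 1 : ι → K) := by
    funext i
    simp only [Pi.sub_apply, Pi.smul_apply, smul_eq_mul, Pi.single_apply]
    by_cases h0 : i = i₀
    · rw [h0, hβ₀, if_pos rfl]; ring
    · rw [if_neg h0]
      by_cases h1 : i = i₁
      · rw [h1, hβ₁]; ring
      · rw [hβe i h0 h1]; ring
  have hc : (θ - θ⁻¹) * (θ - 1) * w i₀ ≠ 0 :=
    mul_ne_zero (mul_ne_zero hθsq (sub_ne_zero.mpr hθ1)) hi₀
  have he₀ : (Pi.single i₀ 1 : ι → K) ∈ W := by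
    have := W.smul_mem ((θ - θ⁻¹) * (θ - 1) * w i₀)⁻¹ (hzeq ▸ hz)
    rwa [smul_smul, inv_mul_cancel₀ hc, one_smul] at this
  -- move `e_{i₀}` to every `e_j` with an even permutation
  have hall : ∀ j, (Pi.single j 1 : ι → K) ∈ W := by
    intro j
    by_cases hj : j = i₀
    · rw [hj]; exact he₀
    have hlt : ({i₀, j} : Finset ι).card < (Finset.univ : Finset ι).card := by
      rw [Finset.card_pair (Ne.symm hj), Finset.card_univ]
      omega
    obtain ⟨l, -, hl⟩ := Finset.exists_mem_notMem_of_card_lt_card hlt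
    simp only [Finset.mem_insert, Finset.mem_singleton, not_or] at hl
    obtain ⟨hl0, hlj⟩ := hl
    set π : Equiv.Perm ι := Equiv.swap j l * Equiv.swap j i₀ with hπ
    have hπj : π j = i₀ := by
      rw [hπ, Equiv.Perm.mul_apply, Equiv.swap_apply_left,
        Equiv.swap_apply_of_ne_of_ne (Ne.symm hj) (Ne.symm hl0)]
    have hsign : Equiv.Perm.sign π = 1 := by
      rw [hπ, map_mul, Equiv.Perm.sign_swap (Ne.symm hlj), Equiv.Perm.sign_swap hj]
      decide
    let P : Matrix.SpecialLinearGroup ι K :=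
      ⟨π.permMatrix K, by rw [Matrix.det_permutation, hsign, Units.val_one, Int.cast_one]⟩
    have hPfix : linSubst ι K (P : Matrix ι ι K) (∑ i : ι, X i ^ D) = ∑ i : ι, X i ^ D :=
      linSubst_permMatrix_sum_X_pow π D
    have := hW P hPfix _ he₀
    change (π.permMatrix K).mulVec (Pi.single i₀ 1) ∈ W at this
    rw [permMatrix_mulVec_single'] at this
    have hπs : π.symm i₀ = j := by rw [← hπj, Equiv.symm_apply_apply]
    rwa [hπs] at this
  refine Submodule.eq_top_iff'.mpr fun v => ?_
  rw [pi_eq_sum_univ' v]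
  exact W.sum_mem fun x _ => W.smul_mem _ (hall x)

/-- **The power sum `∑ xᵢ^D` is polystable over every algebraically closed field with `char ∤ D`,
for `|ι| ≥ 3` and `D ≥ 3`** (Bürgisser–Ikenmeyer 2017 Cor. 2.9, power-sum clause, stated there over
`ℂ` for all `D > 1`; here in every characteristic not dividing `D`, by Kempf's criterion).
[cite: BurgisserIkenmeyer2017, Cor. 2.9 (the form `X₁^D + ⋯ + X_m^D`)] [cite: Kempf1978, Cor. 4.5] -/
theorem isPolystable_sum_X_pow_of_isAlgClosed [IsAlgClosed K] {D : ℕ} (hD : 3 ≤ D) (hDK : (D : K) ≠ 0)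
    (hι : 3 ≤ Fintype.card ι) :
    IsPolystable (∑ i : ι, X i ^ D : MvPolynomial ι K) :=
  isPolystable_of_forall_submodule_sl (isHomogeneous_sum_X_pow_univ D)
    (forall_submodule_stable_sum_X_pow hD hDK hι)

end Literature.Computability.AlgebraicComplexity
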